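import Mathlib.Analysis.Complex.Liouville
import Mathlib.Analysis.Calculus.IteratedDeriv.Lemmas
import Literature.NumberTheory.Transcendental.BakerLogarithmsAnalytic
import HarnessLib

/-!
# A Hermite interpolation (extrapolation) estimate for entire functions: small jets on a finite set

Topic `Literature/NumberTheory/Transcendental`. Support file (proofs only) for Gel'fond's method
WITH derivatives closed by a criterion for algebraic independence, where the auxiliary function
built at a perturbed point has only APPROXIMATELY vanishing Taylor jets at the interpolation points
(the multiplicity analogue of step (c) of Diaz 1989, §II-3-2, formalised without multiplicities in
`InterpolationBound.lean`; needed for Laurent's transcription `Diaz1989_main_iii` of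
Diaz 1989 / Philippon 1986, Thm 2.12 (i), `DiazMain.lean`). We prove, by Hermite's interpolation
formula and the maximum modulus principle (as packaged in `BakerLogarithmsAnalytic.lean`):

* `Hermite.norm_le_of_small_jets`: let `f` be entire, `E` a finite set of `N` points of modulus
  `≤ r` (`r ≥ 1`), pairwise at distance `≥ δ` (`0 < δ ≤ 1`), with `∏_{e' ∈ E, e' ≠ e} |e - e'| ≥ Λ₀ > 0`
  for every `e ∈ E`; if `|f^{(σ)}(e)| ≤ ε` for all `e ∈ E`, `σ < S`, and `|f| ≤ B` on `|z| = R`,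
  `r < R`, then for `|w| ≤ ρ ≤ R`:
  `|f(w)| ≤ 𝓗(ρ) + (B + 𝓗(R))·((ρ + r)/(R - r))^{SN}`, `𝓗(t) = N S ε (2(t+r))^{SN} (2/δ)^S / Λ₀^S`.
* `Hermite.norm_iteratedDeriv_le_of_small_jets`: the same for `|f^{(s)}(w)|`, `|w| ≤ ρ`,
  `ρ + 1 ≤ R`, with the factor `s!` and `ρ + 1` in place of `ρ` (Cauchy's estimate on `|z-w| = 1`).

Proof. With `Λ_e(z) = ∏_{e' ≠ e} ((z - e')/(e - e'))^S`, `φ_e = f/Λ_e` (analytic near `e`),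
`J_e` the Taylor polynomial of order `S` of `φ_e` at `e`, and Hermite's interpolant
`H = ∑_e Λ_e J_e` (a polynomial), the entire function `f - H` vanishes to order `S` at every point
of `E` (`iteratedDeriv_sub_interp_eq_zero`: at `e` the terms `e' ≠ e` carry the factor `(z-e)^S`,
and `Λ_e J_e`, `Λ_e φ_e = f` have the same `S`-jet by Leibniz' rule), so
`|f - H|(w) ≤ (sup_{|z|=R} |f - H| / inf_{|z|=R} |p|)·|p(w)|`, `p = ∏_e (z - e)^S`
(`Baker1975.Analytic.norm_le_of_analyticOrderAt`); and `|H| ≤ 𝓗(t)` on `|z| ≤ t`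
(`norm_interp_le`): `|Λ_e(z)| ≤ (t+r)^{S(N-1)}/Λ₀^S`, the Taylor coefficients of `φ_e` at `e` are
`≤ ε 2^{SN} (2/δ)^S` by Leibniz and Cauchy's estimate for `1/Λ_e` on `|z - e| = δ/2`, where
`|Λ_e| ≥ 2^{-S(N-1)}`. Auxiliary: `iteratedDeriv_taylorPoly(_eq)`, `iteratedDeriv_pow_mul_eq_zero`,
`differentiable_basis`, `basis_eq_pow_mul`, `norm_basis_le`, `le_norm_basis`,
`norm_iteratedDeriv_inv_basis_le`, `basis_self`. Everything here is proved; no definitions (the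
interpolant is handled through defining equations), no named facts.

## References

* G. Diaz, *Grands degrés de transcendance pour des familles d'exponentielles*, J. Number Theory
  31 (1989), 1–23, §II-3-2 (c), pp. 9–10 (the multiplicity-free model). [Diaz1989]
* M. Waldschmidt, *Diophantine Approximation on Linear Algebraic Groups*, Grundlehren 326,
  Springer 2000, §9.1 (interpolation formulas with multiplicities). [folklore]
* A. Baker, *Transcendental Number Theory*, Cambridge Univ. Press 1975, Ch. 2, Lemmas 4–5
  (maximum modulus with multiplicities, as in `BakerLogarithmsAnalytic.lean`). [BakerTNT1975]
-/

noncomputable section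

open Complex Metric Finset Filter Topology

namespace Literature.NumberTheory.Transcendental

namespace Hermite

/-! ### Taylor polynomials and their jets -/

/-- Derivatives at `e` of the polynomial `J(z) = ∑_{i<S} aᵢ (z-e)ⁱ`: `J^{(j)}(e) = j!·a_j` for
`j < S` and `0` otherwise. [folklore] -/
theorem iteratedDeriv_taylorPoly (a : ℕ → ℂ) (e : ℂ) (S j : ℕ) :
    iteratedDeriv j (fun z : ℂ => ∑ i ∈ Finset.range S, a i * (z - e) ^ i) e =
      if j < S then (j.factorial : ℂ) * a j else 0 := by
  rw [iteratedDeriv_fun_sum (fun i _ => by fun_prop)]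
  have key : ∀ i, iteratedDeriv j (fun z : ℂ => a i * (z - e) ^ i) e =
      if j = i then (i.factorial : ℂ) * a i else 0 := by
    intro i
    rw [iteratedDeriv_const_mul _ (by fun_prop)]
    have h : iteratedDeriv j (fun z : ℂ => (z - e) ^ i) =
        fun t => iteratedDeriv j (fun w : ℂ => w ^ i) (t - e) :=
      iteratedDeriv_comp_sub_const j (fun w : ℂ => w ^ i) e
    rw [h]
    simp only [sub_self]
    rw [iteratedDeriv_fun_pow_zero]
    split_ifs <;> ring
  simp_rw [key]
  rw [Finset.sum_ite_eq]
  simp [Finset.mem_range]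

/-- **The Taylor polynomial of order `S` of `φ` at `e` has the same derivatives of order `< S`
at `e` as `φ`.** [folklore] -/
theorem iteratedDeriv_taylorPoly_eq (φ : ℂ → ℂ) (e : ℂ) (S : ℕ) {j : ℕ} (hj : j < S) :
    iteratedDeriv j (fun z : ℂ => ∑ i ∈ Finset.range S,
        (iteratedDeriv i φ e / i.factorial) * (z - e) ^ i) e = iteratedDeriv j φ e := by
  rw [iteratedDeriv_taylorPoly, if_pos hj]
  have : (j.factorial : ℂ) ≠ 0 := by exact_mod_cast Nat.factorial_ne_zero j
  field_simp

/-- A product `(z - e)^S g(z)` with `g` smooth at `e` has vanishing derivatives of order `< S`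
at `e`. [folklore] -/
theorem iteratedDeriv_pow_mul_eq_zero {g : ℂ → ℂ} {e : ℂ} {S j : ℕ} (hj : j < S)
    (hg : ContDiffAt ℂ j g e) :
    iteratedDeriv j (fun z : ℂ => (z - e) ^ S * g z) e = 0 := by
  rw [iteratedDeriv_fun_mul (by fun_prop) hg]
  refine Finset.sum_eq_zero fun i hi => ?_
  have hi' : i ≤ j := Nat.lt_succ_iff.mp (Finset.mem_range.mp hi)
  have h : iteratedDeriv i (fun z : ℂ => (z - e) ^ S) =
      fun t => iteratedDeriv i (fun w : ℂ => w ^ S) (t - e) :=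
    iteratedDeriv_comp_sub_const i (fun w : ℂ => w ^ S) e
  rw [h]
  simp only [sub_self]
  rw [iteratedDeriv_fun_pow_zero, if_neg (by omega)]
  simp

/-! ### The Hermite–Lagrange basis `Λ_e(z) = ∏_{e' ≠ e} ((z - e')/(e - e'))^S` -/

/-- `Λ_e` is entire. [folklore] -/
theorem differentiable_basis (E : Finset ℂ) (e : ℂ) (S : ℕ) :
    Differentiable ℂ (fun z : ℂ => ∏ e' ∈ E.erase e, ((z - e') / (e - e')) ^ S) := by
  have : (fun z : ℂ => ∏ e' ∈ E.erase e, ((z - e') / (e - e')) ^ S) =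
      fun z : ℂ => ∏ e' ∈ E.erase e, ((z - e') * (e - e')⁻¹) ^ S := by
    funext z
    simp [div_eq_mul_inv]
  rw [this]
  fun_prop

/-- `Λ_e` is smooth. [folklore] -/
theorem contDiff_basis (E : Finset ℂ) (e : ℂ) (S : ℕ) {n : WithTop ℕ∞} :
    ContDiff ℂ n (fun z : ℂ => ∏ e' ∈ E.erase e, ((z - e') / (e - e')) ^ S) :=
  (differentiable_basis E e S).contDiff

/-- Splitting off the factor at `e'' ∈ E ∖ {e}`: `Λ_e(z) = (z - e'')^S · g(z)` with `g` entire.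
[folklore] -/
theorem basis_eq_pow_mul (E : Finset ℂ) {e e'' : ℂ} (he'' : e'' ∈ E.erase e) (S : ℕ) :
    ∃ g : ℂ → ℂ, Differentiable ℂ g ∧
      ∀ z, (∏ e' ∈ E.erase e, ((z - e') / (e - e')) ^ S) = (z - e'') ^ S * g z := by
  refine ⟨fun z => ((e - e'')⁻¹) ^ S * ∏ e' ∈ (E.erase e).erase e'', ((z - e') / (e - e')) ^ S,
    ?_, fun z => ?_⟩
  · have hd := differentiable_basis (E.erase e) e'' S
    -- the remaining product is over `(E.erase e).erase e''`, with the same denominators `e - e'`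
    have : Differentiable ℂ
        (fun z : ℂ => ∏ e' ∈ (E.erase e).erase e'', ((z - e') / (e - e')) ^ S) := by
      have h2 : (fun z : ℂ => ∏ e' ∈ (E.erase e).erase e'', ((z - e') / (e - e')) ^ S) =
          fun z : ℂ => ∏ e' ∈ (E.erase e).erase e'', ((z - e') * (e - e')⁻¹) ^ S := by
        funext z; simp [div_eq_mul_inv]
      rw [h2]; fun_prop
    exact (differentiable_const _).mul this
  · rw [← Finset.mul_prod_erase _ _ he'']
    rw [div_pow, div_eq_mul_inv, ← inv_pow]
    ring

/-- **Upper bound for `Λ_e`**: if `|z| ≤ t` and `|e'| ≤ r` on `E`, then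
`|Λ_e(z)| ≤ (t + r)^{S·#(E∖{e})} / (∏_{e'≠e} |e - e'|)^S`. [folklore] -/
theorem norm_basis_le (E : Finset ℂ) (e : ℂ) (S : ℕ) {r t : ℝ} (hE : ∀ e' ∈ E, ‖e'‖ ≤ r)
    {z : ℂ} (hz : ‖z‖ ≤ t) :
    ‖∏ e' ∈ E.erase e, ((z - e') / (e - e')) ^ S‖ ≤
      (t + r) ^ (S * (E.erase e).card) / (∏ e' ∈ E.erase e, ‖e - e'‖) ^ S := by
  rw [norm_prod]
  have h1 : ∀ e' ∈ E.erase e, ‖((z - e') / (e - e')) ^ S‖ = ‖z - e'‖ ^ S / ‖e - e'‖ ^ S := by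
    intro e' _
    rw [norm_pow, norm_div, div_pow]
  rw [Finset.prod_congr rfl h1, Finset.prod_div_distrib]
  simp only [Finset.prod_pow]
  have hprod : 0 < ∏ e' ∈ E.erase e, ‖e - e'‖ :=
    Finset.prod_pos fun e' he' => norm_pos_iff.mpr (sub_ne_zero.mpr (Finset.ne_of_mem_erase he').symm)
  have hpos : 0 < (∏ e' ∈ E.erase e, ‖e - e'‖) ^ S := by positivity
  rw [div_le_div_iff_of_pos_right hpos]
  calc (∏ e' ∈ E.erase e, ‖z - e'‖) ^ S ≤ (∏ _e' ∈ E.erase e, (t + r)) ^ S := by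
        refine pow_le_pow_left₀ (Finset.prod_nonneg fun _ _ => norm_nonneg _) ?_ _
        refine Finset.prod_le_prod (fun _ _ => norm_nonneg _) fun e' he' => ?_
        calc ‖z - e'‖ ≤ ‖z‖ + ‖e'‖ := norm_sub_le _ _
          _ ≤ t + r := add_le_add hz (hE e' (Finset.mem_of_mem_erase he'))
    _ = (t + r) ^ (S * (E.erase e).card) := by
        rw [Finset.prod_const, ← pow_mul, mul_comm]

/-- **Lower bound for `Λ_e` near `e`**: if the points of `E` are pairwise `δ`-separated and
`|z - e| ≤ δ/2`, each factor has modulus `≥ 1/2`, so `|Λ_e(z)| ≥ 2^{-S·#(E∖{e})}`. [folklore] -/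
theorem le_norm_basis (E : Finset ℂ) {e : ℂ} (he : e ∈ E) (S : ℕ) {δ : ℝ} (hδ : 0 < δ)
    (hsep : ∀ e₁ ∈ E, ∀ e₂ ∈ E, e₁ ≠ e₂ → δ ≤ ‖e₁ - e₂‖) {z : ℂ} (hz : ‖z - e‖ ≤ δ / 2) :
    ((1 : ℝ) / 2) ^ (S * (E.erase e).card) ≤ ‖∏ e' ∈ E.erase e, ((z - e') / (e - e')) ^ S‖ := by
  rw [norm_prod]
  calc ((1 : ℝ) / 2) ^ (S * (E.erase e).card) = ∏ _e' ∈ E.erase e, ((1 : ℝ) / 2) ^ S := by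
        rw [Finset.prod_const, ← pow_mul]
    _ ≤ ∏ e' ∈ E.erase e, ‖((z - e') / (e - e')) ^ S‖ := by
        refine Finset.prod_le_prod (fun _ _ => by positivity) fun e' he' => ?_
        rw [norm_pow]
        refine pow_le_pow_left₀ (by norm_num) ?_ _
        have hne : e' ≠ e := Finset.ne_of_mem_erase he'
        have he'E : e' ∈ E := Finset.mem_of_mem_erase he'
        have hd : δ ≤ ‖e - e'‖ := hsep e he e' he'E hne.symm
        have hpos : 0 < ‖e - e'‖ := lt_of_lt_of_le hδ hd
        rw [norm_div, le_div_iff₀ hpos]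
        -- `|z - e'| ≥ |e - e'| - |z - e| ≥ |e - e'| - δ/2 ≥ |e - e'|/2`
        have : ‖e - e'‖ - ‖z - e‖ ≤ ‖z - e'‖ := by
          have := norm_sub_norm_le (e - e') (e - z)
          rw [show e - e' - (e - z) = z - e' by ring, norm_sub_rev e z] at this
          linarith
        linarith

/-- **Cauchy's estimate for `1/Λ_e` at `e`**: with `δ`-separated points,
`|(1/Λ_e)^{(j)}(e)| ≤ j! · 2^{S·#(E∖{e})} / (δ/2)^j`. [folklore] -/
theorem norm_iteratedDeriv_inv_basis_le (E : Finset ℂ) {e : ℂ} (he : e ∈ E) (S : ℕ) {δ : ℝ}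
    (hδ : 0 < δ) (hsep : ∀ e₁ ∈ E, ∀ e₂ ∈ E, e₁ ≠ e₂ → δ ≤ ‖e₁ - e₂‖) (j : ℕ) :
    ‖iteratedDeriv j (fun z : ℂ => (∏ e' ∈ E.erase e, ((z - e') / (e - e')) ^ S)⁻¹) e‖ ≤
      j.factorial * (2 : ℝ) ^ (S * (E.erase e).card) / (δ / 2) ^ j := by
  have hR : 0 < δ / 2 := by positivity
  -- `Λ_e` does not vanish on the closed disc `|z - e| ≤ δ/2`
  have hne : ∀ z ∈ closedBall e (δ / 2), (∏ e' ∈ E.erase e, ((z - e') / (e - e')) ^ S) ≠ 0 := by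
    intro z hz
    have hz' : ‖z - e‖ ≤ δ / 2 := by simpa [dist_eq_norm] using hz
    have := le_norm_basis E he S hδ hsep hz'
    intro h0
    rw [h0, norm_zero] at this
    exact absurd this (not_le.mpr (by positivity))
  have hdiff : DiffContOnCl ℂ
      (fun z : ℂ => (∏ e' ∈ E.erase e, ((z - e') / (e - e')) ^ S)⁻¹) (ball e (δ / 2)) := by
    refine DifferentiableOn.diffContOnCl ?_
    rw [closure_ball e hR.ne']
    intro z hz
    exact (((differentiable_basis E e S) z).inv (hne z hz)).differentiableWithinAt
  have hC : ∀ z ∈ sphere e (δ / 2),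
      ‖(∏ e' ∈ E.erase e, ((z - e') / (e - e')) ^ S)⁻¹‖ ≤ (2 : ℝ) ^ (S * (E.erase e).card) := by
    intro z hz
    have hz' : ‖z - e‖ ≤ δ / 2 := by
      have : dist z e = δ / 2 := hz
      rw [dist_eq_norm] at this
      exact this.le
    have hlow := le_norm_basis E he S hδ hsep hz'
    rw [norm_inv, inv_le_comm₀ (lt_of_lt_of_le (by positivity) hlow) (by positivity)]
    calc ((2 : ℝ) ^ (S * (E.erase e).card))⁻¹ = ((1 : ℝ) / 2) ^ (S * (E.erase e).card) := by
          rw [one_div, inv_pow]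
      _ ≤ _ := hlow
  have := Complex.norm_iteratedDeriv_le_of_forall_mem_sphere_norm_le j hR hdiff hC
  simpa [mul_div_assoc] using this

/-- `Λ_e(e) = 1`. [folklore] -/
theorem basis_self (E : Finset ℂ) (e : ℂ) (S : ℕ) :
    (∏ e' ∈ E.erase e, ((e - e') / (e - e')) ^ S) = 1 := by
  refine Finset.prod_eq_one fun e' he' => ?_
  have hne : e - e' ≠ 0 := sub_ne_zero.mpr (Finset.ne_of_mem_erase he').symm
  rw [div_self hne, one_pow]

/-! ### The Hermite interpolant `H = ∑_e Λ_e · J_S[f/Λ_e]_e` and its jets -/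

/-- **Hermite's formula interpolates the `S`-jets.** With `Λ_e` the basis above,
`φ_e = f/Λ_e` (analytic near `e`), `J_e` the Taylor polynomial of order `S` of `φ_e` at `e`
and `H = ∑_{e ∈ E} Λ_e J_e`, the entire function `f - H` has vanishing derivatives of all
orders `< S` at every point of `E`: at `e`, the terms `Λ_{e'}J_{e'}`, `e' ≠ e`, contain the
factor `(z - e)^S`, and `Λ_eJ_e` has the same `S`-jet as `Λ_eφ_e = f` by Leibniz' rule. (The
functions are passed with their defining equations to avoid auxiliary definitions.) [folklore] -/
theorem iteratedDeriv_sub_interp_eq_zero {f : ℂ → ℂ} (hf : Differentiable ℂ f) (E : Finset ℂ)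
    (S : ℕ) (Λ φ : ℂ → ℂ → ℂ) (a : ℂ → ℕ → ℂ) (J : ℂ → ℂ → ℂ) (H : ℂ → ℂ)
    (hΛ : Λ = fun e z => ∏ e' ∈ E.erase e, ((z - e') / (e - e')) ^ S)
    (hφ : φ = fun e z => f z * (Λ e z)⁻¹)
    (ha : a = fun e k => iteratedDeriv k (φ e) e / k.factorial)
    (hJ : J = fun e z => ∑ k ∈ Finset.range S, a e k * (z - e) ^ k)
    (hH : H = fun z => ∑ e ∈ E, Λ e z * J e z)
    {e : ℂ} (he : e ∈ E) {j : ℕ} (hj : j < S) :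
    iteratedDeriv j (fun z => f z - H z) e = 0 := by
  -- differentiability of the pieces
  have hΛd : ∀ e', Differentiable ℂ (Λ e') := fun e' => by
    rw [hΛ]; exact differentiable_basis E e' S
  have hJd : ∀ e', Differentiable ℂ (J e') := fun e' => by
    rw [hJ]; simp only; fun_prop
  have hHd : Differentiable ℂ H := by
    rw [hH]; exact Differentiable.fun_sum fun e' _ => (hΛd e').mul (hJd e')
  have hΛe : Λ e e = 1 := by rw [hΛ]; exact basis_self E e S
  have hφc : ContDiffAt ℂ j (φ e) e := by
    rw [hφ]
    exact (hf.contDiff.contDiffAt).mul (((hΛd e).contDiff.contDiffAt).inv (by rw [hΛe]; exact one_ne_zero))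
  -- `D^j (f - H)(e) = D^j f(e) - D^j H(e)`
  rw [iteratedDeriv_fun_sub hf.contDiff.contDiffAt hHd.contDiff.contDiffAt]
  rw [sub_eq_zero]
  -- `D^j H(e) = ∑_{e'} D^j(Λ_{e'} J_{e'})(e)`
  have hsum : iteratedDeriv j H e = ∑ e' ∈ E, iteratedDeriv j (fun z => Λ e' z * J e' z) e := by
    rw [hH]
    exact iteratedDeriv_fun_sum fun e' _ => ((hΛd e').mul (hJd e')).contDiff.contDiffAt
  rw [hsum, ← Finset.add_sum_erase E _ he]
  -- the terms `e' ≠ e` vanish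
  have hzero : ∀ e' ∈ E.erase e, iteratedDeriv j (fun z => Λ e' z * J e' z) e = 0 := by
    intro e' he'
    have hmem : e ∈ E.erase e' :=
      Finset.mem_erase.mpr ⟨(Finset.ne_of_mem_erase he').symm, he⟩
    obtain ⟨g, hg, hgeq⟩ := basis_eq_pow_mul E hmem S
    have hfun : (fun z => Λ e' z * J e' z) = fun z => (z - e) ^ S * (g z * J e' z) := by
      funext z
      have : Λ e' z = (z - e) ^ S * g z := by rw [hΛ]; exact hgeq z
      rw [this]; ring
    rw [hfun]
    exact iteratedDeriv_pow_mul_eq_zero hj ((hg.mul (hJd e')).contDiff.contDiffAt)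
  rw [Finset.sum_eq_zero hzero, add_zero]
  -- the term `e' = e`: Leibniz for `Λ_e J_e` and for `Λ_e φ_e`
  rw [iteratedDeriv_fun_mul ((hΛd e).contDiff.contDiffAt) ((hJd e).contDiff.contDiffAt)]
  have hJφ : ∀ i ∈ Finset.range (j + 1),
      iteratedDeriv (j - i) (J e) e = iteratedDeriv (j - i) (φ e) e := by
    intro i _
    rw [hJ, ha]
    exact iteratedDeriv_taylorPoly_eq (φ e) e S (by omega)
  rw [Finset.sum_congr rfl fun i hi => by rw [hJφ i hi]]
  rw [← iteratedDeriv_fun_mul ((hΛd e).contDiff.contDiffAt) hφc]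
  -- `Λ_e φ_e = f` near `e`
  refine Filter.EventuallyEq.iteratedDeriv_eq j ?_
  have hopen : IsOpen {z : ℂ | Λ e z ≠ 0} :=
    isOpen_ne_fun (hΛd e).continuous continuous_const
  have hmem : e ∈ {z : ℂ | Λ e z ≠ 0} := by
    show Λ e e ≠ 0
    rw [hΛe]; exact one_ne_zero
  filter_upwards [hopen.mem_nhds hmem] with z hz
  have hz' : Λ e z ≠ 0 := hz
  rw [hφ]
  simp only
  field_simp

/-- **Size of the Hermite interpolant.** With `|e| ≤ r` on `E` (`r ≥ 1`), pairwise distances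
`≥ δ ∈ (0, 1]`, `∏_{e' ≠ e}|e - e'| ≥ Λ₀ > 0` and `|f^{(σ)}(e)| ≤ ε` for `σ < S`, `e ∈ E`:
for `|z| ≤ t` (`t ≥ 0`), `|H(z)| ≤ N·S·ε·(2(t+r))^{SN}·(2/δ)^S/Λ₀^S`, `N = #E`. Ingredients:
`|Λ_e(z)| ≤ (t+r)^{S(N-1)}/Λ₀^S`; by Leibniz and Cauchy's estimate for `1/Λ_e` on `|z-e| = δ/2`
(where `|Λ_e| ≥ 2^{-S(N-1)}`), the Taylor coefficients of `φ_e = f/Λ_e` at `e` are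
`≤ ε·2^{SN}(2/δ)^S`. [folklore] -/
theorem norm_interp_le {f : ℂ → ℂ} (hf : Differentiable ℂ f) (E : Finset ℂ) (S : ℕ)
    {r δ Λ₀ ε : ℝ} (hr : 1 ≤ r) (hδ : 0 < δ) (hδ1 : δ ≤ 1) (hΛ₀ : 0 < Λ₀) (hε : 0 ≤ ε)
    (hE : ∀ e ∈ E, ‖e‖ ≤ r) (hsep : ∀ e₁ ∈ E, ∀ e₂ ∈ E, e₁ ≠ e₂ → δ ≤ ‖e₁ - e₂‖)
    (hprod : ∀ e ∈ E, Λ₀ ≤ ∏ e' ∈ E.erase e, ‖e - e'‖)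
    (hsmall : ∀ e ∈ E, ∀ σ < S, ‖iteratedDeriv σ f e‖ ≤ ε)
    (Λ φ : ℂ → ℂ → ℂ) (a : ℂ → ℕ → ℂ) (J : ℂ → ℂ → ℂ) (H : ℂ → ℂ)
    (hΛ : Λ = fun e z => ∏ e' ∈ E.erase e, ((z - e') / (e - e')) ^ S)
    (hφ : φ = fun e z => f z * (Λ e z)⁻¹)
    (ha : a = fun e k => iteratedDeriv k (φ e) e / k.factorial)
    (hJ : J = fun e z => ∑ k ∈ Finset.range S, a e k * (z - e) ^ k)
    (hH : H = fun z => ∑ e ∈ E, Λ e z * J e z)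
    {t : ℝ} (ht : 0 ≤ t) {z : ℂ} (hz : ‖z‖ ≤ t) :
    ‖H z‖ ≤ E.card * S * ε * (2 * (t + r)) ^ (S * E.card) * (2 / δ) ^ S / Λ₀ ^ S := by
  set N : ℕ := E.card with hN
  have hΛd : ∀ e', Differentiable ℂ (Λ e') := fun e' => by
    rw [hΛ]; exact differentiable_basis E e' S
  have htr : 1 ≤ t + r := by linarith
  have h2δ : 1 ≤ 2 / δ := by rw [le_div_iff₀ hδ]; linarith
  -- (1) the Taylor coefficients of `φ_e` at `e`
  have hcoef : ∀ e ∈ E, ∀ k < S, ‖a e k‖ ≤ ε * 2 ^ (S * N) * (2 / δ) ^ S := by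
    intro e he k hk
    have hcard : (E.erase e).card = N - 1 := by rw [Finset.card_erase_of_mem he]
    have hN1 : 1 ≤ N := Finset.card_pos.mpr ⟨e, he⟩
    have hΛe : Λ e e = 1 := by rw [hΛ]; exact basis_self E e S
    have hinvc : ContDiffAt ℂ k (fun z => (Λ e z)⁻¹) e :=
      ((hΛd e).contDiff.contDiffAt).inv (by rw [hΛe]; exact one_ne_zero)
    -- Leibniz
    have hL : iteratedDeriv k (φ e) e = ∑ i ∈ Finset.range (k + 1),
        (k.choose i : ℂ) * iteratedDeriv i f e * iteratedDeriv (k - i) (fun z => (Λ e z)⁻¹) e := by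
      rw [hφ]
      exact iteratedDeriv_fun_mul hf.contDiff.contDiffAt hinvc
    -- Cauchy for `1/Λ_e`
    have hinv : ∀ i, ‖iteratedDeriv i (fun z => (Λ e z)⁻¹) e‖ ≤
        i.factorial * (2 : ℝ) ^ (S * (N - 1)) / (δ / 2) ^ i := by
      intro i
      have := norm_iteratedDeriv_inv_basis_le E he S hδ hsep i
      rw [hcard] at this
      rw [hΛ]
      exact this
    -- termwise bound: `choose · ε · k! 2^{S(N-1)} (2/δ)^S`
    have hterm : ∀ i ∈ Finset.range (k + 1),
        ‖(k.choose i : ℂ) * iteratedDeriv i f e * iteratedDeriv (k - i) (fun z => (Λ e z)⁻¹) e‖ ≤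
          (k.choose i : ℝ) * (ε * (k.factorial * (2 : ℝ) ^ (S * (N - 1)) * (2 / δ) ^ S)) := by
      intro i hi
      have hik : i ≤ k := Nat.lt_succ_iff.mp (Finset.mem_range.mp hi)
      rw [norm_mul, norm_mul, Complex.norm_natCast, mul_assoc]
      refine mul_le_mul_of_nonneg_left ?_ (Nat.cast_nonneg _)
      refine mul_le_mul (hsmall e he i (by omega)) ?_ (norm_nonneg _) hε
      calc ‖iteratedDeriv (k - i) (fun z => (Λ e z)⁻¹) e‖
          ≤ (k - i).factorial * (2 : ℝ) ^ (S * (N - 1)) / (δ / 2) ^ (k - i) := hinv (k - i)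
        _ = (k - i).factorial * (2 : ℝ) ^ (S * (N - 1)) * (2 / δ) ^ (k - i) := by
            rw [div_eq_mul_inv, ← inv_pow, inv_div]
        _ ≤ k.factorial * (2 : ℝ) ^ (S * (N - 1)) * (2 / δ) ^ S := by
            gcongr
            · exact Nat.sub_le k i
            · omega
    have hnorm : ‖iteratedDeriv k (φ e) e‖ ≤
        (2 : ℝ) ^ k * (ε * (k.factorial * (2 : ℝ) ^ (S * (N - 1)) * (2 / δ) ^ S)) := by
      rw [hL]
      calc ‖∑ i ∈ Finset.range (k + 1), (k.choose i : ℂ) * iteratedDeriv i f e *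
              iteratedDeriv (k - i) (fun z => (Λ e z)⁻¹) e‖
          ≤ ∑ i ∈ Finset.range (k + 1), ‖(k.choose i : ℂ) * iteratedDeriv i f e *
              iteratedDeriv (k - i) (fun z => (Λ e z)⁻¹) e‖ := norm_sum_le _ _
        _ ≤ ∑ i ∈ Finset.range (k + 1),
              (k.choose i : ℝ) * (ε * (k.factorial * (2 : ℝ) ^ (S * (N - 1)) * (2 / δ) ^ S)) :=
            Finset.sum_le_sum hterm
        _ = (2 : ℝ) ^ k * (ε * (k.factorial * (2 : ℝ) ^ (S * (N - 1)) * (2 / δ) ^ S)) := by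
            rw [← Finset.sum_mul]
            congr 1
            have := Nat.sum_range_choose k
            exact_mod_cast this
    -- divide by `k!`
    have hkf : (0 : ℝ) < k.factorial := by exact_mod_cast Nat.factorial_pos k
    rw [ha]
    simp only
    rw [norm_div, Complex.norm_natCast, div_le_iff₀ hkf]
    calc ‖iteratedDeriv k (φ e) e‖
        ≤ (2 : ℝ) ^ k * (ε * (k.factorial * (2 : ℝ) ^ (S * (N - 1)) * (2 / δ) ^ S)) := hnorm
      _ = (2 : ℝ) ^ k * (2 : ℝ) ^ (S * (N - 1)) * (ε * (2 / δ) ^ S * k.factorial) := by ring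
      _ ≤ (2 : ℝ) ^ S * (2 : ℝ) ^ (S * (N - 1)) * (ε * (2 / δ) ^ S * k.factorial) := by
          gcongr
          · norm_num
      _ = ε * 2 ^ (S * N) * (2 / δ) ^ S * k.factorial := by
          rw [← pow_add]
          have : S + S * (N - 1) = S * N := by
            obtain ⟨N', hN'⟩ : ∃ N', N = N' + 1 := ⟨N - 1, by omega⟩
            rw [hN', Nat.add_sub_cancel]; ring
          rw [this]; ring
  -- (2) the Taylor polynomials
  have hJb : ∀ e ∈ E, ‖J e z‖ ≤ S * (ε * 2 ^ (S * N) * (2 / δ) ^ S) * (t + r) ^ S := by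
    intro e he
    rw [hJ]
    simp only
    have hze : ‖z - e‖ ≤ t + r :=
      (norm_sub_le _ _).trans (add_le_add hz (hE e he))
    calc ‖∑ k ∈ Finset.range S, a e k * (z - e) ^ k‖
        ≤ ∑ k ∈ Finset.range S, ‖a e k * (z - e) ^ k‖ := norm_sum_le _ _
      _ ≤ ∑ k ∈ Finset.range S, (ε * 2 ^ (S * N) * (2 / δ) ^ S) * (t + r) ^ S := by
          refine Finset.sum_le_sum fun k hk => ?_
          have hkS : k < S := Finset.mem_range.mp hk
          rw [norm_mul, norm_pow]
          refine mul_le_mul (hcoef e he k hkS) ?_ (by positivity) (by positivity)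
          exact (pow_le_pow_left₀ (norm_nonneg _) hze k).trans (pow_le_pow_right₀ htr hkS.le)
      _ = S * (ε * 2 ^ (S * N) * (2 / δ) ^ S) * (t + r) ^ S := by
          rw [Finset.sum_const, Finset.card_range, nsmul_eq_mul]; ring
  -- (3) the basis
  have hΛb : ∀ e ∈ E, ‖Λ e z‖ ≤ (t + r) ^ (S * (N - 1)) / Λ₀ ^ S := by
    intro e he
    have hcard : (E.erase e).card = N - 1 := by rw [Finset.card_erase_of_mem he]
    rw [hΛ]
    simp only
    calc ‖∏ e' ∈ E.erase e, ((z - e') / (e - e')) ^ S‖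
        ≤ (t + r) ^ (S * (E.erase e).card) / (∏ e' ∈ E.erase e, ‖e - e'‖) ^ S :=
          norm_basis_le E e S hE hz
      _ ≤ (t + r) ^ (S * (N - 1)) / Λ₀ ^ S := by
          rw [hcard]
          refine div_le_div_of_nonneg_left (by positivity) (by positivity) ?_
          exact pow_le_pow_left₀ hΛ₀.le (hprod e he) S
  -- (4) summation
  rw [hH]
  simp only
  by_cases hE0 : E = ∅
  · subst hE0; simp
  have hN1 : 1 ≤ N := Finset.card_pos.mpr (Finset.nonempty_iff_ne_empty.mpr hE0)
  calc ‖∑ e ∈ E, Λ e z * J e z‖ ≤ ∑ e ∈ E, ‖Λ e z * J e z‖ := norm_sum_le _ _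
    _ ≤ ∑ e ∈ E, (t + r) ^ (S * (N - 1)) / Λ₀ ^ S *
          (S * (ε * 2 ^ (S * N) * (2 / δ) ^ S) * (t + r) ^ S) := by
        refine Finset.sum_le_sum fun e he => ?_
        rw [norm_mul]
        exact mul_le_mul (hΛb e he) (hJb e he) (norm_nonneg _) (by positivity)
    _ = N * ((t + r) ^ (S * (N - 1)) / Λ₀ ^ S *
          (S * (ε * 2 ^ (S * N) * (2 / δ) ^ S) * (t + r) ^ S)) := by
        rw [Finset.sum_const, nsmul_eq_mul]
    _ = E.card * S * ε * (2 * (t + r)) ^ (S * E.card) * (2 / δ) ^ S / Λ₀ ^ S := by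
        rw [← hN, mul_pow]
        have e1 : (t + r) ^ (S * (N - 1)) * (t + r) ^ S = (t + r) ^ (S * N) := by
          rw [← pow_add]
          congr 1
          obtain ⟨N', hN'⟩ : ∃ N', N = N' + 1 := ⟨N - 1, by omega⟩
          rw [hN']; simp [Nat.mul_succ]
        field_simp
        rw [← e1]
        ring

/-! ### The extrapolation estimate -/

/-- **Hermite extrapolation with approximate data** (the multiplicity analogue of
`Interp.norm_le_of_small_on_finset`, `InterpolationBound.lean`). Let `f` be entire, `E` a finite
set of `N` points of modulus `≤ r` (`r ≥ 1`), pairwise at distance `≥ δ ∈ (0,1]`, with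
`∏_{e' ≠ e} |e - e'| ≥ Λ₀ > 0` for all `e ∈ E`; suppose `|f^{(σ)}(e)| ≤ ε` for all `e ∈ E`,
`σ < S`, and `|f| ≤ B` on `|z| = R`, `r < R`. Then for `|w| ≤ ρ ≤ R`,
`|f(w)| ≤ 𝓗(ρ) + (B + 𝓗(R)) · ((ρ + r)/(R - r))^{SN}`, where
`𝓗(t) = N S ε (2(t+r))^{SN} (2/δ)^S / Λ₀^S` bounds the Hermite interpolant on `|z| ≤ t`.
Proof: `f - H` vanishes to order `S` on `E` (`iteratedDeriv_sub_interp_eq_zero`), so the maximum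
modulus principle for `(f - H)/∏(z - e)^S` (`Baker1975.Analytic.norm_le_of_analyticOrderAt`)
gives `|f - H|(w) ≤ sup_{|z|=R}|f - H| · |∏(w - e)^S| / inf_{|z|=R}|∏(z - e)^S|`. [folklore] -/
theorem norm_le_of_small_jets {f : ℂ → ℂ} (hf : Differentiable ℂ f) (E : Finset ℂ) (S : ℕ)
    {r R ρ δ Λ₀ ε B : ℝ} (hr : 1 ≤ r) (hρ : 0 ≤ ρ) (hρR : ρ ≤ R) (hrR : r < R) (hδ : 0 < δ)
    (hδ1 : δ ≤ 1) (hΛ₀ : 0 < Λ₀) (hε : 0 ≤ ε)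
    (hE : ∀ e ∈ E, ‖e‖ ≤ r) (hsep : ∀ e₁ ∈ E, ∀ e₂ ∈ E, e₁ ≠ e₂ → δ ≤ ‖e₁ - e₂‖)
    (hprod : ∀ e ∈ E, Λ₀ ≤ ∏ e' ∈ E.erase e, ‖e - e'‖)
    (hsmall : ∀ e ∈ E, ∀ σ < S, ‖iteratedDeriv σ f e‖ ≤ ε)
    (hB : ∀ z ∈ sphere (0 : ℂ) R, ‖f z‖ ≤ B) {w : ℂ} (hw : ‖w‖ ≤ ρ) :
    ‖f w‖ ≤ E.card * S * ε * (2 * (ρ + r)) ^ (S * E.card) * (2 / δ) ^ S / Λ₀ ^ S +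
      (B + E.card * S * ε * (2 * (R + r)) ^ (S * E.card) * (2 / δ) ^ S / Λ₀ ^ S) *
        ((ρ + r) / (R - r)) ^ (S * E.card) := by
  -- the interpolant and its two properties
  set Λ : ℂ → ℂ → ℂ := fun e z => ∏ e' ∈ E.erase e, ((z - e') / (e - e')) ^ S with hΛ
  set φ : ℂ → ℂ → ℂ := fun e z => f z * (Λ e z)⁻¹ with hφ
  set a : ℂ → ℕ → ℂ := fun e k => iteratedDeriv k (φ e) e / k.factorial with ha
  set J : ℂ → ℂ → ℂ := fun e z => ∑ k ∈ Finset.range S, a e k * (z - e) ^ k with hJ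
  set H : ℂ → ℂ := fun z => ∑ e ∈ E, Λ e z * J e z with hH
  set 𝓗 : ℝ → ℝ := fun t => E.card * S * ε * (2 * (t + r)) ^ (S * E.card) * (2 / δ) ^ S / Λ₀ ^ S
    with h𝓗
  have hHb : ∀ {t : ℝ}, 0 ≤ t → ∀ {z : ℂ}, ‖z‖ ≤ t → ‖H z‖ ≤ 𝓗 t := fun ht z hz =>
    norm_interp_le hf E S hr hδ hδ1 hΛ₀ hε hE hsep hprod hsmall Λ φ a J H rfl rfl rfl rfl rfl ht hz
  have hjets : ∀ e ∈ E, ∀ j < S, iteratedDeriv j (fun z => f z - H z) e = 0 := fun e he j hj =>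
    iteratedDeriv_sub_interp_eq_zero hf E S Λ φ a J H rfl rfl rfl rfl rfl he hj
  -- `g = f - H` is entire and vanishes to order `S` on `E`
  have hΛd : ∀ e', Differentiable ℂ (Λ e') := fun e' => differentiable_basis E e' S
  have hJd : ∀ e', Differentiable ℂ (J e') := fun e' => by
    show Differentiable ℂ fun z => ∑ k ∈ Finset.range S, a e' k * (z - e') ^ k
    fun_prop
  have hHd : Differentiable ℂ H := Differentiable.fun_sum fun e' _ => (hΛd e').mul (hJd e')
  have hg : Differentiable ℂ (fun z => f z - H z) := hf.sub hHd
  have horder : ∀ c ∈ E, (S : ℕ∞) ≤ analyticOrderAt (fun z => f z - H z) c := fun c hc =>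
    Baker1975.Analytic.le_analyticOrderAt_of_iteratedDeriv_eq_zero hg (hjets c hc)
  -- bounds on the circle `|z| = R`
  have hR : 0 < R := by linarith
  have hB0 : 0 ≤ B := by
    have hz : ((R : ℝ) : ℂ) ∈ sphere (0 : ℂ) R := by simp [hR.le]
    exact (norm_nonneg _).trans (hB _ hz)
  have hθ : ∀ z ∈ sphere (0 : ℂ) R, ‖f z - H z‖ ≤ B + 𝓗 R := by
    intro z hz
    have hzR : ‖z‖ ≤ R := by
      have : ‖z‖ = R := by simpa using hz
      exact this.le
    exact (norm_sub_le _ _).trans (add_le_add (hB z hz) (hHb hR.le hzR))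
  have hm : 0 < (R - r) ^ (S * E.card) := pow_pos (by linarith) _
  have hmF : ∀ z ∈ sphere (0 : ℂ) R, (R - r) ^ (S * E.card) ≤ ‖∏ c ∈ E, (z - c) ^ S‖ := by
    intro z hz
    have hzR : ‖z‖ = R := by simpa using hz
    refine Baker1975.Analytic.le_norm_prod_pow E S (by linarith) fun c hc => ?_
    have := norm_sub_norm_le z c
    have := hE c hc
    linarith
  have key := Baker1975.Analytic.norm_le_of_analyticOrderAt hg E S horder hR hθ hm hmF
    (hw.trans hρR)
  have hprodw : ‖∏ c ∈ E, (w - c) ^ S‖ ≤ (ρ + r) ^ (S * E.card) :=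
    Baker1975.Analytic.norm_prod_pow_le E S fun c hc =>
      (norm_sub_le _ _).trans (add_le_add hw (hE c hc))
  -- assemble
  have h1 : ‖f w‖ ≤ ‖H w‖ + ‖f w - H w‖ := by
    have := norm_add_le (H w) (f w - H w)
    rwa [add_sub_cancel] at this
  have h𝓗R : 0 ≤ 𝓗 R := by simp only [h𝓗]; positivity
  calc ‖f w‖ ≤ ‖H w‖ + ‖f w - H w‖ := h1
    _ ≤ 𝓗 ρ + (B + 𝓗 R) / (R - r) ^ (S * E.card) * ‖∏ c ∈ E, (w - c) ^ S‖ :=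
        add_le_add (hHb hρ hw) key
    _ ≤ 𝓗 ρ + (B + 𝓗 R) / (R - r) ^ (S * E.card) * (ρ + r) ^ (S * E.card) := by
        gcongr
    _ = 𝓗 ρ + (B + 𝓗 R) * ((ρ + r) / (R - r)) ^ (S * E.card) := by
        rw [div_pow]; ring

/-- **Hermite extrapolation, derivative form**: under the hypotheses of `norm_le_of_small_jets`
with `ρ + 1 ≤ R`, for `|w| ≤ ρ` and every `s`,
`|f^{(s)}(w)| ≤ s! · (𝓗(ρ+1) + (B + 𝓗(R))((ρ+1+r)/(R-r))^{SN})` (Cauchy's estimate on the circle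
`|z - w| = 1`). [folklore] -/
theorem norm_iteratedDeriv_le_of_small_jets {f : ℂ → ℂ} (hf : Differentiable ℂ f)
    (E : Finset ℂ) (S : ℕ) {r R ρ δ Λ₀ ε B : ℝ} (hr : 1 ≤ r) (hρ : 0 ≤ ρ) (hρR : ρ + 1 ≤ R)
    (hrR : r < R) (hδ : 0 < δ) (hδ1 : δ ≤ 1) (hΛ₀ : 0 < Λ₀) (hε : 0 ≤ ε)
    (hE : ∀ e ∈ E, ‖e‖ ≤ r) (hsep : ∀ e₁ ∈ E, ∀ e₂ ∈ E, e₁ ≠ e₂ → δ ≤ ‖e₁ - e₂‖)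
    (hprod : ∀ e ∈ E, Λ₀ ≤ ∏ e' ∈ E.erase e, ‖e - e'‖)
    (hsmall : ∀ e ∈ E, ∀ σ < S, ‖iteratedDeriv σ f e‖ ≤ ε)
    (hB : ∀ z ∈ sphere (0 : ℂ) R, ‖f z‖ ≤ B) {w : ℂ} (hw : ‖w‖ ≤ ρ) (s : ℕ) :
    ‖iteratedDeriv s f w‖ ≤ s.factorial *
      (E.card * S * ε * (2 * (ρ + 1 + r)) ^ (S * E.card) * (2 / δ) ^ S / Λ₀ ^ S +
        (B + E.card * S * ε * (2 * (R + r)) ^ (S * E.card) * (2 / δ) ^ S / Λ₀ ^ S) *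
          ((ρ + 1 + r) / (R - r)) ^ (S * E.card)) := by
  have hC : ∀ z ∈ sphere w 1, ‖f z‖ ≤
      E.card * S * ε * (2 * (ρ + 1 + r)) ^ (S * E.card) * (2 / δ) ^ S / Λ₀ ^ S +
        (B + E.card * S * ε * (2 * (R + r)) ^ (S * E.card) * (2 / δ) ^ S / Λ₀ ^ S) *
          ((ρ + 1 + r) / (R - r)) ^ (S * E.card) := by
    intro z hz
    have hzw : ‖z - w‖ = 1 := by
      have : dist z w = 1 := hz
      rwa [dist_eq_norm] at this
    have hz1 : ‖z‖ ≤ ρ + 1 := by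
      have := norm_le_norm_add_norm_sub' z w  -- ‖z‖ ≤ ‖w‖ + ‖z - w‖? check name
      linarith
    exact norm_le_of_small_jets hf E S hr (by linarith) hρR hrR hδ hδ1 hΛ₀ hε hE hsep hprod hsmall
      hB hz1
  have := Complex.norm_iteratedDeriv_le_of_forall_mem_sphere_norm_le s zero_lt_one hf.diffContOnCl hC
  simpa using this

end Hermite

end Literature.NumberTheory.Transcendental

end
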